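import Mathlib
import HarnessLib
import Summits.QuantumFields.BalabanUV.Beta.LinearizingChange267Jet

/-!
# [Balaban1987RG1] §2 p. 267 FROM `Q̃` ALONE: the linearizing change of variables `B′ = B − hD̃(B)` with every piece of
# abstract data of `LinearizingChange267` ∕ `…Jet` (the non-linear part `C̃`, its Lipschitz constant, its quadratic onset,
# the radii `r, ρ, σ`) CONSTRUCTED from: `Q̃` analytic on a ball with `Q̃(0) = 0` and a sup bound, and a bounded right
# inverse `h` of `LQ̃ := DQ̃(0)` (cell topic `Summits/QuantumFields/BalabanUV/Beta`; row-D4 terminal leaf (T4)(a))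

HONEST FRAMING (cell rule).  Discharging `BetaPertH` makes Bałaban's UV stability UNCONDITIONAL — a real constructive-QFT
result; NOT the continuum limit, NOT the Clay problem.  This module discharges NOTHING of `BetaPertH`.  It closes the ABSTRACT
side of the by-assertion sentence of [I] p. 267 (gens 30∕31 of this lineage: `LinearizingChange267`, `LinearizingChange267Jet`):
there the non-linear part `C̃` was INPUT as «λ-Lipschitz on a closed r-ball, `C^ω` on the open one, `C̃ 0 = 0`, quadratic onset
`‖C̃x‖ ≤ M‖x‖²`» together with radii `ρ + ‖h‖σ < r`, `λr ≤ σ`, `λ‖h‖ < 1`; here ALL of that is DERIVED, with explicit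
constants, from hypotheses on the printed object `Q̃` itself — analytic on `ball 0 R`, `Q̃(0) = 0`, `‖Q̃‖ ≤ M_Q` there — and a
bounded right inverse `h` of `A := DQ̃(0)` («LQ̃h = I»).  What then remains between the kernel and Bałaban's `D̃` is only the
[dict] item «Bałaban's Q̃ of (2.4) — the k-fold averaging map in the chart `B′ = (1∕i)log V′` — is analytic near 0, vanishes
at 0, is bounded on a polydisc of k-UNIFORM radius, and p. 267's explicit `h` is a right inverse of its linearisation with
k-uniform norm» (B7∕[I] §1-level facts about the averaging operation).  Bookkeeping-grade; NOT summit progress.  Unit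
`b2b-balaban-beta-an4-g31` (owner of `BINDER-OWNERS.md` row D4).

CITATION HEADER (lean-in-tree rule).  [I] = T. Bałaban, *Renormalization group approach to lattice gauge field theories. I.
Generation of effective actions in a small field approximation and a coupling constant renormalization in four dimensions*,
Commun. Math. Phys. **109**, 249–301 (1987) [Balaban1987RG1] (PDF page = journal page − 248).  WHAT IS REPRODUCED — p. 266
[PDF 18] (render `HOME/b2b-balaban-ref1/pages/1987-cmp109-rg-I-small-field/…-p018-x2.png`, READ AS AN IMAGE), verbatim:
*"The expression under the δ-function is equal to M(V′V^{(k)})M(V^{(k)})⁻¹ = exp iQ̃(B′). (2.4)"*; p. 267 [PDF 19] (render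
`…-p019-x2.png`, read as an image), verbatim: *"In this integral we make a change of variables linearizing the function Q̃(B′).
… Furthermore, the operator h satisfies the identity LQ̃h = I on T^{(k+1)}. Of course h is uniquely defined by these conditions,
in fact it is a very simple operator given by the equality (hB)(b₀(c)) = h(c)B(c), where h(c) is a linear operator on the Lie
algebra 𝐠, equal to an inverse of a coefficient at the variable B′(b₀(c)) in (Q̃B′)(c), multiplied by L⁻¹. We are looking
for an analytic, 𝐠-valued function D̃(B′), defined at bonds of T^{(k+1)}, and such that the transformation B′ = B − hD̃(B)
linearizes the function Q̃(B′). The function D̃(B) is determined by the equation LQ̃B′ + C̃(B′) = LQ̃B − D̃(B) + C̃(B −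
hD̃(B)) = LQ̃B.  It is easy to prove, following the proofs in the above mentioned papers, that there exists exactly one
solution of this equation, and that it is an analytic function of B."*

ABSOLUTE RULE (cell).  "No internally-minted statement may enter as a cited fact. Every hypothesis is either kernel-proved in
this package or a verbatim quotation of a PUBLISHED theorem with page reference. The manuscript(s) under audit are NOT citable
for their own disputed steps — they are the thing under adjudication; programme-internal (2001∕route∕tribunal) claims are never
citable."  Nothing is cited as a fact: everything below is PROVED from Mathlib and from ACCEPTED tree modules used BY NAME
(`LinearizingChange267.exists_unique_analytic_linearizer`, `…Jet.norm_fderiv_le_of_sq_bound` ∕ `census_bounds_tildeD` ∕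
`homPart_tildeD_two_eq`, `B13ExpansionOrder.beginsAt_one` ∕ `pow_bound_rem` ∕ `homPart_one`).

READING (recorded as such).  `Qt : E → F` = the printed «Q̃» ((2.4): the k-fold averaging `M` of `V′V^{(k)}` against that of
`V^{(k)}`, in the chart `B′ = (1∕i)log V′`; `E` = 𝔤ᶜ-valued functions on the bonds of `T^{(k)}`, `F` = on `T^{(k+1)}`); `A :=
fderiv ℂ Qt 0` = «LQ̃»; `nonlin Qt := Qt − A` = «C̃» (so «LQ̃B′ + C̃(B′)» IS `Qt B′`); `h : F →L[ℂ] E` with `A ∘ h = id` =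
«LQ̃h = I».  HYPOTHESES (the [dict] residue, stated): `Qt` analytic on `ball 0 R` (`0 < R`), `Qt 0 = 0`, `‖Qt z‖ ≤ M_Q` on the
ball, and `h`.  EVERYTHING ELSE IS CONSTRUCTED: quadratic constant `Mq := 2M_Q∕R²`, radius `r := R∕(8(1 + Mq‖h‖R))`, Lipschitz
constant `λ := 4Mq·r`, `σ := λr`, `ρ := r∕4`.

PROVED ([folklore], constants explicit).  §1 `nonlin Qt` vanishes at 0, equals `B13ExpansionOrder.rem Qt 1`, has QUADRATIC ONSET
`‖C̃x‖ ≤ Mq‖x‖²` on `ball 0 R` (`pow_bound_rem`, n = 1), is analytic∕`C^ω` on the ball, has `‖DC̃(z)‖ ≤ 4Mq·s` on `‖z‖ ≤ s`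
(`2s < R∕2`; gen 31's Cauchy step) and is `λ`-LIPSCHITZ on `closedBall 0 r` (mean value inequality).  §2 the radii satisfy
gen 30's three inequalities (`radii_ok`).  §3 **`linearizer_of_Q`** = [I] p. 267 FROM `Q̃`: with `D̃ := tildeD (nonlin Qt) h ρ σ`,
(i) `Q̃(B − hD̃B) = LQ̃B` for `‖B‖ ≤ ρ` («the transformation B′ = B − hD̃(B) linearizes the function Q̃(B′)»), (ii) uniqueness in the
σ-ball, (iii) `D̃0 = 0`, (iv) `D̃` analytic on `ball 0 ρ`; **`census_of_Q`** — the (2.12)-census inputs `‖D̃w‖ ≤ (σ∕ρ²)‖w‖²`,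
`‖D̃₃w‖ ≤ (2σ∕ρ³)‖w‖³`; **`homPart_two_of_Q`** — «D̃^{(2)} = C̃^{(2)}».

NOT CLAIMED.  That Bałaban's averaging-in-the-chart `Q̃` satisfies the four hypotheses with k-UNIFORM `R, M_Q, ‖h‖` (B7 ∕ [I] §1
facts + compactness of `G`; [dict]); the concrete formula `(hB)(b₀(c)) = h(c)B(c)`; anything of [II]; NOT summit progress.
-/

namespace Summit.QuantumFields.BalabanUV.Beta.LinearizingChange267FromQ

open Metric Set Filter
open scoped NNReal Topology ContDiff
open Summit.QuantumFields.BalabanUV.Beta.LinearizingChange267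
open Summit.QuantumFields.BalabanUV.Beta.LinearizingChange267Jet
open Literature.MathematicalPhysics.QuantumFieldTheory.Balaban1983to89.B13ExpansionOrder (BeginsAt homPart rem
  beginsAt_one pow_bound_rem homPart_one)

noncomputable section

variable {E : Type*} [NormedAddCommGroup E] [NormedSpace ℂ E] [CompleteSpace E]
  {F : Type*} [NormedAddCommGroup F] [NormedSpace ℂ F] [CompleteSpace F]

/-! ## §1 The non-linear part `C̃ := Q̃ − LQ̃` and its constants -/

/-- The printed non-linear part «C̃» of `Q̃`: `C̃(x) = Q̃(x) − LQ̃x` with `LQ̃ := DQ̃(0)`. [cite: Balaban1987RG1, §2 p.267] -/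
def nonlin (Qt : E → F) : E → F := fun x => Qt x - fderiv ℂ Qt 0 x

omit [CompleteSpace E] [CompleteSpace F] in
/-- `Q̃ = LQ̃ + C̃` — so the printed left side «LQ̃B′ + C̃(B′)» is `Q̃(B′)`. [folklore] -/
theorem apply_eq_lin_add_nonlin (Qt : E → F) (x : E) : Qt x = fderiv ℂ Qt 0 x + nonlin Qt x := by
  simp [nonlin]

omit [CompleteSpace E] [CompleteSpace F] in
/-- `C̃(0) = 0` when `Q̃(0) = 0`. [folklore] -/
theorem nonlin_zero {Qt : E → F} (h0 : Qt 0 = 0) : nonlin Qt 0 = 0 := by simp [nonlin, h0]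

omit [CompleteSpace E] [CompleteSpace F] in
/-- `C̃` is the order-1 REMAINDER `rem Q̃ 1 = Q̃ − Q̃^{(1)}` of the census module (`homPart_one`: `Q̃^{(1)}w = DQ̃(0)w`). [folklore] -/
theorem nonlin_eq_rem {Qt : E → F} (hQ : DifferentiableAt ℂ Qt 0) : nonlin Qt = rem Qt 1 := by
  funext x
  simp [nonlin, rem, homPart_one hQ]

variable {Qt : E → F} {R MQ : ℝ} {h : F →L[ℂ] E}

omit [CompleteSpace E] in
/-- **QUADRATIC ONSET OF `C̃`, DERIVED**: `Q̃` differentiable with `‖Q̃‖ ≤ M_Q` on `ball 0 R` and `Q̃(0) = 0` ⟹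
`‖C̃x‖ ≤ (2M_Q∕R²)‖x‖²` on the ball (`B13ExpansionOrder.pow_bound_rem` with `n = 1`, `beginsAt_one`). [folklore] -/
theorem nonlin_sq_bound (hR : 0 < R) (hQ : DifferentiableOn ℂ Qt (ball 0 R)) (hM : ∀ z ∈ ball (0 : E) R, ‖Qt z‖ ≤ MQ)
    (h0 : Qt 0 = 0) : ∀ x ∈ ball (0 : E) R, ‖nonlin Qt x‖ ≤ 2 * MQ / R ^ 2 * ‖x‖ ^ 2 := by
  intro x hx
  rw [nonlin_eq_rem (hQ.differentiableAt (ball_mem_nhds _ hR))]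
  simpa using pow_bound_rem hQ hM (beginsAt_one hR hQ h0) x hx

omit [CompleteSpace E] in
/-- … hence on the CLOSED ball of radius `R∕2`. [folklore] -/
theorem nonlin_sq_bound_closed (hR : 0 < R) (hQ : DifferentiableOn ℂ Qt (ball 0 R))
    (hM : ∀ z ∈ ball (0 : E) R, ‖Qt z‖ ≤ MQ) (h0 : Qt 0 = 0) :
    ∀ x ∈ closedBall (0 : E) (R / 2), ‖nonlin Qt x‖ ≤ 2 * MQ / R ^ 2 * ‖x‖ ^ 2 := fun x hx =>
  nonlin_sq_bound hR hQ hM h0 x (mem_ball_zero_iff.mpr (by have := mem_closedBall_zero_iff.mp hx; linarith))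

omit [CompleteSpace E] [CompleteSpace F] in
/-- `C̃` is analytic on `ball 0 R` (where `Q̃` is). [folklore] -/
theorem analyticOnNhd_nonlin (hQ : AnalyticOnNhd ℂ Qt (ball 0 R)) : AnalyticOnNhd ℂ (nonlin Qt) (ball 0 R) :=
  fun z hz => (hQ z hz).sub ((fderiv ℂ Qt 0).analyticAt z)

omit [CompleteSpace E] in
/-- `C̃` is `C^ω` at every point of the open ball (the form `LinearizingChange267` consumes). [folklore] -/
theorem contDiffAt_nonlin (hQ : AnalyticOnNhd ℂ Qt (ball 0 R)) {r : ℝ} (hr : r ≤ R) :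
    ∀ x ∈ ball (0 : E) r, ContDiffAt ℂ ω (nonlin Qt) x :=
  fun x hx => (analyticOnNhd_nonlin hQ x (ball_subset_ball hr hx)).contDiffAt

omit [NormedSpace ℂ E] [CompleteSpace E] [NormedSpace ℂ F] [CompleteSpace F] in
/-- `0 ≤ M_Q` (the sup bound at the centre). [folklore] -/
theorem MQ_nonneg (hR : 0 < R) (hM : ∀ z ∈ ball (0 : E) R, ‖Qt z‖ ≤ MQ) : 0 ≤ MQ :=
  (norm_nonneg _).trans (hM 0 (mem_ball_self hR))

omit [CompleteSpace E] in
/-- **LIPSCHITZ CONSTANT OF `C̃`, DERIVED**: for `0 < s`, `4s < R`: `C̃` is `(4·(2M_Q∕R²)·s)`-Lipschitz on `closedBall 0 s`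
(gen 31's Cauchy step `norm_fderiv_le_of_sq_bound` on the shells `s < 2s < R∕2` + the mean value inequality). [folklore] -/
theorem lipschitzOnWith_nonlin (hR : 0 < R) (hQ : AnalyticOnNhd ℂ Qt (ball 0 R)) (hM : ∀ z ∈ ball (0 : E) R, ‖Qt z‖ ≤ MQ)
    (h0 : Qt 0 = 0) {s : ℝ} (hs : 0 < s) (h4s : 4 * s < R) :
    LipschitzOnWith (Real.toNNReal (4 * (2 * MQ / R ^ 2) * s)) (nonlin Qt) (closedBall (0 : E) s) := by
  have hMq : 0 ≤ 2 * MQ / R ^ 2 := by have := MQ_nonneg hR hM; positivity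
  have hdiff : DifferentiableOn ℂ (nonlin Qt) (ball (0 : E) (R / 2)) :=
    ((analyticOnNhd_nonlin hQ).mono (ball_subset_ball (by linarith))).differentiableOn
  have hder : ∀ z ∈ closedBall (0 : E) s, ‖fderiv ℂ (nonlin Qt) z‖₊ ≤ Real.toNNReal (4 * (2 * MQ / R ^ 2) * s) := by
    intro z hz
    have h1 := norm_fderiv_le_of_sq_bound hMq hdiff (nonlin_sq_bound_closed hR hQ.differentiableOn hM h0) hs
      (by linarith) (mem_closedBall_zero_iff.mp hz)
    rw [← NNReal.coe_le_coe, coe_nnnorm, Real.coe_toNNReal _ (by positivity)]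
    exact h1
  have hdiffAt : ∀ z ∈ closedBall (0 : E) s, DifferentiableAt ℂ (nonlin Qt) z := fun z hz =>
    (analyticOnNhd_nonlin hQ z (mem_ball_zero_iff.mpr (by have := mem_closedBall_zero_iff.mp hz; linarith))).differentiableAt
  exact (convex_closedBall (0 : E) s).lipschitzOnWith_of_nnnorm_fderiv_le hdiffAt hder

/-! ## §2 The explicit radii -/

/-- The quadratic constant `Mq = 2M_Q∕R²`. [folklore] -/
def Mq (R MQ : ℝ) : ℝ := 2 * MQ / R ^ 2

/-- The Lipschitz ball radius `r = R ∕ (8(1 + Mq‖h‖R))` (so `8r ≤ R` and `4·Mq·r·‖h‖ ≤ ½`). [folklore] -/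
def rad (R MQ κ : ℝ) : ℝ := R / (8 * (1 + Mq R MQ * κ * R))

/-- `0 < r`. [folklore] -/
theorem rad_pos (hR : 0 < R) (hMQ : 0 ≤ MQ) {κ : ℝ} (hκ : 0 ≤ κ) : 0 < rad R MQ κ := by
  unfold rad Mq; positivity

/-- `8r ≤ R` (so `4r < R`, `2r < R∕2`, `r ≤ R∕2`). [folklore] -/
theorem eight_rad_le (hR : 0 < R) (hMQ : 0 ≤ MQ) {κ : ℝ} (hκ : 0 ≤ κ) : 8 * rad R MQ κ ≤ R := by
  unfold rad Mq
  have h1 : (1 : ℝ) ≤ 1 + 2 * MQ / R ^ 2 * κ * R := by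
    have : 0 ≤ 2 * MQ / R ^ 2 * κ * R := by positivity
    linarith
  rw [← mul_div_assoc, mul_div_mul_left _ _ (by norm_num : (8 : ℝ) ≠ 0)]
  exact div_le_self hR.le h1

/-- The contraction margin: `4·Mq·r·κ ≤ ½` (κ = ‖h‖). [folklore] -/
theorem contraction_half (hR : 0 < R) (hMQ : 0 ≤ MQ) {κ : ℝ} (hκ : 0 ≤ κ) :
    4 * Mq R MQ * rad R MQ κ * κ ≤ 1 / 2 := by
  unfold rad
  set m := Mq R MQ with hm
  have hm0 : 0 ≤ m := by rw [hm]; unfold Mq; positivity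
  have hden : 0 < 8 * (1 + m * κ * R) := by positivity
  rw [show 4 * m * (R / (8 * (1 + m * κ * R))) * κ = (4 * (m * κ * R)) / (8 * (1 + m * κ * R)) by ring,
    div_le_iff₀ hden]
  nlinarith [mul_nonneg (mul_nonneg hm0 hκ) hR.le]

/-! ## §3 [I] p. 267 from `Q̃` -/

omit [CompleteSpace E] in
/-- **THE STANDING DATA OF gens 30∕31, CONSTRUCTED**: with `C̃ = nonlin Qt`, `λ = 4·Mq·r` (as `Real.toNNReal`), `σ = λr`,
`ρ = r∕4`, `r = rad R M_Q ‖h‖`: `C̃0 = 0`, `C̃` is λ-Lipschitz on `closedBall 0 r`, `ρ + ‖h‖σ < r`, `λr ≤ σ`, `0 ≤ σ`, `0 < ρ`,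
`λ‖h‖ < 1`, `C̃` is `C^ω` on `ball 0 r`, and `‖C̃x‖ ≤ Mq‖x‖²` on `closedBall 0 r`. [folklore] -/
theorem radii_ok (hR : 0 < R) (hQ : AnalyticOnNhd ℂ Qt (ball 0 R)) (hM : ∀ z ∈ ball (0 : E) R, ‖Qt z‖ ≤ MQ)
    (h0 : Qt 0 = 0) (h : F →L[ℂ] E) :
    let r := rad R MQ ‖h‖; let lam := Real.toNNReal (4 * Mq R MQ * r); let σ := (lam : ℝ) * r; let ρ := r / 4
    nonlin Qt 0 = 0 ∧ LipschitzOnWith lam (nonlin Qt) (closedBall (0 : E) r) ∧ ρ + ‖h‖ * σ < r ∧ (lam : ℝ) * r ≤ σ ∧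
      0 ≤ σ ∧ 0 < ρ ∧ (lam : ℝ) * ‖h‖ < 1 ∧ (∀ x ∈ ball (0 : E) r, ContDiffAt ℂ ω (nonlin Qt) x) ∧
      ∀ x ∈ closedBall (0 : E) r, ‖nonlin Qt x‖ ≤ Mq R MQ * ‖x‖ ^ 2 := by
  intro r lam σ ρ
  have hMQ := MQ_nonneg hR hM
  have hr0 : 0 < r := rad_pos hR hMQ (norm_nonneg h)
  have h8 : 8 * r ≤ R := eight_rad_le hR hMQ (norm_nonneg h)
  have hc : 4 * Mq R MQ * r * ‖h‖ ≤ 1 / 2 := contraction_half hR hMQ (norm_nonneg h)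
  have hMq0 : 0 ≤ Mq R MQ := by unfold Mq; positivity
  have hlam : (lam : ℝ) = 4 * Mq R MQ * r := Real.coe_toNNReal _ (by positivity)
  refine ⟨nonlin_zero h0, ?_, ?_, le_rfl, by positivity, by positivity, ?_, contDiffAt_nonlin hQ (by linarith), ?_⟩
  · exact lipschitzOnWith_nonlin hR hQ hM h0 hr0 (by linarith)
  · -- ρ + ‖h‖σ = r/4 + ‖h‖·λ·r ≤ r/4 + r/2 < r
    show r / 4 + ‖h‖ * ((lam : ℝ) * r) < r
    have : ‖h‖ * ((lam : ℝ) * r) ≤ r / 2 := by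
      rw [hlam]; nlinarith [hc, hr0.le, norm_nonneg h]
    linarith
  · rw [hlam]; linarith
  · intro x hx
    have hx' : x ∈ closedBall (0 : E) (R / 2) := closedBall_subset_closedBall (by linarith) hx
    simpa [Mq] using nonlin_sq_bound_closed hR hQ.differentiableOn hM h0 x hx'

/-- **[I] p. 267 FROM `Q̃`**: `Q̃` analytic on `ball 0 R` with `Q̃(0) = 0`, `‖Q̃‖ ≤ M_Q`, and `h` a bounded right inverse of
`LQ̃ = DQ̃(0)`.  With the CONSTRUCTED radii of §2 and `D̃ := tildeD (nonlin Qt) h ρ σ`: (i) «the transformation B′ = B − hD̃(B)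
linearizes the function Q̃(B′)»: `Q̃(B − hD̃B) = LQ̃B` for `‖B‖ ≤ ρ`; (ii) «exactly one solution»: any `D` with `‖D‖ ≤ σ` and
`Q̃(B − hD) = LQ̃B` is `D̃B`; (iii) `D̃0 = 0`; (iv) «an analytic function of B»: `D̃` is analytic on `ball 0 ρ`
(`LinearizingChange267.exists_unique_analytic_linearizer` with every hypothesis discharged by `radii_ok`). [cite: Balaban1987RG1, §2 p.267] -/
theorem linearizer_of_Q (hR : 0 < R) (hQ : AnalyticOnNhd ℂ Qt (ball 0 R)) (hM : ∀ z ∈ ball (0 : E) R, ‖Qt z‖ ≤ MQ)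
    (h0 : Qt 0 = 0) (h : F →L[ℂ] E) (hAh : ∀ D, fderiv ℂ Qt 0 (h D) = D) :
    let r := rad R MQ ‖h‖; let σ := (Real.toNNReal (4 * Mq R MQ * r) : ℝ) * r; let ρ := r / 4
    let Dt := tildeD (nonlin Qt) h ρ σ
    (∀ B ∈ closedBall (0 : E) ρ, Qt (B - h (Dt B)) = fderiv ℂ Qt 0 B) ∧
      (∀ B ∈ closedBall (0 : E) ρ, ∀ D ∈ closedBall (0 : F) σ, Qt (B - h D) = fderiv ℂ Qt 0 B → D = Dt B) ∧
      Dt 0 = 0 ∧ AnalyticOnNhd ℂ Dt (ball (0 : E) ρ) := by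
  intro r σ ρ Dt
  obtain ⟨hC0, hLip, hr, hσ, hσ0, hρ0, hq, hCω, -⟩ := radii_ok hR hQ hM h0 h
  obtain ⟨h1, h2, h3, h4⟩ :=
    exists_unique_analytic_linearizer (fderiv ℂ Qt 0) h hAh hC0 hLip hr hσ hσ0 hρ0.le hq hCω
  refine ⟨fun B hB => ?_, fun B hB D hD hsol => h2 B hB D hD ?_, h3, h4⟩
  · have := h1 B hB
    rwa [← apply_eq_lin_add_nonlin] at this
  · rwa [← apply_eq_lin_add_nonlin]

/-- **THE (2.12)-CENSUS INPUTS FROM `Q̃`**: with the same constructed data, `‖D̃w‖ ≤ (σ∕ρ²)‖w‖²` and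
`‖D̃₃w‖ ≤ (2σ∕ρ³)‖w‖³` on `ball 0 ρ` (`LinearizingChange267Jet.census_bounds_tildeD`, hypotheses discharged).
[cite: Balaban1987RG1, (2.12) p.268] -/
theorem census_of_Q (hR : 0 < R) (hQ : AnalyticOnNhd ℂ Qt (ball 0 R)) (hM : ∀ z ∈ ball (0 : E) R, ‖Qt z‖ ≤ MQ)
    (h0 : Qt 0 = 0) (h : F →L[ℂ] E) :
    let r := rad R MQ ‖h‖; let σ := (Real.toNNReal (4 * Mq R MQ * r) : ℝ) * r; let ρ := r / 4
    let Dt := tildeD (nonlin Qt) h ρ σ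
    (∀ w ∈ ball (0 : E) ρ, ‖Dt w‖ ≤ σ / ρ ^ 2 * ‖w‖ ^ 2) ∧
      ∀ w ∈ ball (0 : E) ρ, ‖rem Dt 2 w‖ ≤ 2 * σ / ρ ^ 3 * ‖w‖ ^ 3 := by
  intro r σ ρ Dt
  obtain ⟨hC0, hLip, hr, hσ, hσ0, hρ0, hq, hCω, hquad⟩ := radii_ok hR hQ hM h0 h
  have hMq0 : 0 ≤ Mq R MQ := by unfold Mq; have := MQ_nonneg hR hM; positivity
  exact census_bounds_tildeD hC0 hLip hr hσ hσ0 hρ0 hq hCω hMq0 hquad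

/-- **«D̃^{(2)} = C̃^{(2)}» FROM `Q̃`**: the order-2 part of `D̃` equals that of `C̃ = Q̃ − LQ̃`
(`LinearizingChange267Jet.homPart_tildeD_two_eq`, hypotheses discharged). [cite: Balaban1987RG1, §2 p.267] -/
theorem homPart_two_of_Q (hR : 0 < R) (hQ : AnalyticOnNhd ℂ Qt (ball 0 R)) (hM : ∀ z ∈ ball (0 : E) R, ‖Qt z‖ ≤ MQ)
    (h0 : Qt 0 = 0) (h : F →L[ℂ] E) (w : E) :
    let r := rad R MQ ‖h‖; let σ := (Real.toNNReal (4 * Mq R MQ * r) : ℝ) * r; let ρ := r / 4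
    homPart (tildeD (nonlin Qt) h ρ σ) 2 w = homPart (nonlin Qt) 2 w := by
  intro r σ ρ
  obtain ⟨hC0, hLip, hr, hσ, hσ0, hρ0, hq, hCω, hquad⟩ := radii_ok hR hQ hM h0 h
  have hMq0 : 0 ≤ Mq R MQ := by unfold Mq; have := MQ_nonneg hR hM; positivity
  exact homPart_tildeD_two_eq hC0 hLip hr hσ hσ0 hρ0 hq hCω hMq0 hquad w

end

end Summit.QuantumFields.BalabanUV.Beta.LinearizingChange267FromQ
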